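import Mathlib
import Summits.Ventures.PercRepro2.LocRows
import Summits.Ventures.PercRepro2.SwRow
import Summits.Ventures.PercRepro2.SwOut
import Summits.Ventures.PercRepro2.SwAllRow
import Summits.Ventures.PercRepro2.SwOutAll
import Summits.Ventures.PercRepro2.SwOutArmFlip
import Summits.Ventures.PercRepro2.SwOutArmThm
import Summits.Ventures.PercRepro2.SwOutCoreDefs
import Summits.Ventures.PercRepro2.SwOutCoreHull
import Summits.Ventures.PercRepro2.SwOutCoreDual
import Summits.Ventures.PercRepro2.SwOutShadowDefs
import Summits.Ventures.PercRepro2.SwOutShadowCube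
import Summits.Ventures.PercRepro2.SwOutCoreShadowDefs
import Summits.Ventures.PercRepro2.SwOutCoreShadowFlip
import Summits.Ventures.PercRepro2.SwOutCoreToggle
import Summits.Ventures.PercRepro2.SwOutCoreShadowArm
import Summits.Ventures.PercRepro2.SwOutCoreShadowUnion
import Summits.Ventures.PercRepro2.SwOutEdgeDefs
import Summits.Ventures.PercRepro2.SwOutEdgeHull
import Summits.Ventures.PercRepro2.SwOutEdgeDual
import Summits.Ventures.PercRepro2.SwOutEdgeShadow
import Summits.Ventures.PercRepro2.SwOutEdgeShadowFlip
import Summits.Ventures.PercRepro2.SwOutEdgeShadowArm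

/-!
# Orbit points at a one-sided point of an e-core cube (blind cell PercRepro2, night-4 g16,
2026-08-26; proofs/NIGHT4-G16.md §4)

`SwOutCoreShadowUnion` for an e-core base (the junction `u` adjacent to `h`): at a point whose
coarse arms are `sX` and the far arms, a union of coarse arms is `sX` (or nothing) with a far
selection (`armsUnionE_eq`, `flip_armsUnionE_eq`), and a one-sided e-cube point is core-free
(`CoreBaseE.coreFree_coreRealE`).  The hb-free parts (`armsUnion`, `exists_armsUnion_of_mem_orbit`,
the `_congr` lemmas, `farSel`, `shadowSel_far_eq`) are those of the tree.
-/

namespace Summit.Ventures.PercRepro2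

namespace LocRows

open Hull

variable {V : Type*} {E : Type*} [Fintype E] [DecidableEq E]

open scoped Classical

variable {ends : E → Sym2 V}

section Decomp

variable {ι : Type*} {A : ι → Set V} {pure : ι → Prop} {ζ : Config E} {h u : V} {H : Set V}
  (hb : CoreBaseE ends ζ h u H A pure) {ω₀ : Config ι} (hconn : ArmsConnected A ends)
  {η : Config E} (hH : hull ends η h = {h} ∪ {x | ∃ j, x ∈ sB ends u A ω₀ j})
include hb hconn hH

omit [DecidableEq E] in
/-- **A union of coarse arms is `sX` (or nothing) with a far selection.** -/
theorem armsUnionE_eq (p : Set V → Prop) :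
    armsUnion (arms ends η h) p =
      {x | p (sX ends u A ω₀) ∧ x ∈ sX ends u A ω₀} ∪ farSel ends u A p := by
  ext x
  simp only [armsUnion, farSel, armsSel, Set.mem_union, Set.mem_setOf_eq]
  constructor
  · rintro ⟨P, hP, hpP, hxP⟩
    obtain ⟨j, rfl⟩ := hb.exists_sB_of_mem_arms hconn hH hP
    rcases j with _ | ⟨i, hi⟩
    · exact Or.inl ⟨hpP, hxP⟩
    · exact Or.inr ⟨i, ⟨hi, hpP⟩, hxP⟩
  · rintro (⟨hpX, hx⟩ | ⟨i, ⟨hi, hpi⟩, hx⟩)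
    · exact ⟨_, hb.sX_mem_arms hconn hH, hpX, hx⟩
    · exact ⟨_, hb.far_mem_arms hconn hH hi, hpi, hx⟩

omit [Fintype E] [DecidableEq E] hconn in
/-- No edge joins `sX` to a far selection. -/
lemma CoreBaseE.not_touches_sX_farSel (p : Set V → Prop) {e : E}
    (hX : e ∈ touches ends (sX ends u A ω₀)) (hF : e ∈ touches ends (farSel ends u A p)) : False := by
  obtain ⟨x, hx, y, hxy⟩ := hX
  obtain ⟨z, ⟨i, ⟨hi, _⟩, hzi⟩, w, hzw⟩ := hF
  rw [hxy, Sym2.eq_iff] at hzw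
  rcases hzw with ⟨h1, _⟩ | ⟨_, h2⟩
  · rw [← h1] at hzi
    rcases mem_sX_iff.1 hx with rfl | ⟨i', hi', _, hxi'⟩
    · exact hb.u_notMem_arm i hzi
    · exact hi (by
        have : i' = i := by
          by_contra hne
          exact hb.arm_disj i' i hne x hxi' hzi
        subst this; exact hi')
  · rw [← h2] at hzi
    exact hb.no_edge_sX_far hH hxy hx hi hzi

omit [DecidableEq E] in
/-- **The flip of a union of coarse arms**: the far selection after `sX` (when selected). -/
theorem flip_armsUnionE_eq (p : Set V → Prop) (ρ : Config E) :
    flip ends (armsUnion (arms ends η h) p) ρ =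
      flip ends (farSel ends u A p) (if p (sX ends u A ω₀) then flip ends (sX ends u A ω₀) ρ else ρ) := by
  rw [armsUnionE_eq hb hconn hH]
  by_cases hpX : p (sX ends u A ω₀)
  · have hset : {x | p (sX ends u A ω₀) ∧ x ∈ sX ends u A ω₀} = sX ends u A ω₀ := by
      ext x; simp [hpX]
    rw [hset, if_pos hpX, flip_union_of_not_both]
    · exact flip_comm _ _ _
    · exact fun e hX hF => hb.not_touches_sX_farSel hH p hX hF
  · have hset : {x | p (sX ends u A ω₀) ∧ x ∈ sX ends u A ω₀} = (∅ : Set V) := by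
      ext x; simp [hpX]
    rw [hset, if_neg hpX, Set.empty_union]

end Decomp

section CoreFree

variable {ι : Type*} {A : ι → Set V} {pure : ι → Prop} {ζ : Config E} {h u : V} {H : Set V}

omit [Fintype E] [DecidableEq E] in
/-- A one-sided e-cube point is core-free. -/
theorem CoreBaseE.coreFree_coreRealE (hb : CoreBaseE ends ζ h u H A pure) {ω : Config (Option ι)}
    (hω : ¬ (uRedE ends A u pure ω ∧ uRedE ends A u pure (flipAll ω))) :
    CoreFree ends (coreRealE ends A h u ζ ω) h := by
  intro x hx hx'
  rw [hb.cluster_coreRealE, mem_redSetE_iff] at hx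
  rw [hb.cluster_blue_coreRealE, mem_redSetE_iff] at hx'
  have key : ∀ i j, ω (some i) = true → flipAll ω (some j) = true → x ∈ A i → x ∈ A j → False := by
    intro i j hi hj hxi hxj
    have : i = j := by
      by_contra hne
      exact hb.arm_disj i j hne x hxi hxj
    subst this
    simp only [flipAll, hi] at hj
    exact absurd hj (by decide)
  rcases hx with rfl | ⟨i, hi, _, hxi⟩ | ⟨huR, rfl | ⟨i, hi, _, hxi⟩⟩
  · rfl
  · rcases hx' with rfl | ⟨j, hj, _, hxj⟩ | ⟨_, rfl | ⟨j, hj, _, hxj⟩⟩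
    · rfl
    · exact (key i j hi hj hxi hxj).elim
    · exact (hb.u_notMem_arm i hxi).elim
    · exact (key i j hi hj hxi hxj).elim
  · rcases hx' with rfl | ⟨j, _, _, hxj⟩ | ⟨huB, _⟩
    · rfl
    · exact (hb.u_notMem_arm j hxj).elim
    · exact (hω ⟨huR, huB⟩).elim
  · rcases hx' with rfl | ⟨j, hj, _, hxj⟩ | ⟨_, rfl | ⟨j, hj, _, hxj⟩⟩
    · rfl
    · exact (key i j hi hj hxi hxj).elim
    · exact (hb.u_notMem_arm i hxi).elim
    · exact (key i j hi hj hxi hxj).elim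

end CoreFree


end LocRows

end Summit.Ventures.PercRepro2
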